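import Literature.Analysis.FluidPDE.PlanarGraphBandKinematics
import Literature.Analysis.FluidPDE.PlanarStreamGluing
import HarnessLib

/-!
# The run element: a straight band translating transversally with an arbitrary material map

Topic `Literature/Analysis/FluidPDE`. Element file of the explicit pullback calculus for the
planar transport equation (series `PlanarPullbackKinematics`, …, `PlanarChainCutoffs`). A
**horizontal run** of a rectilinear channel is the graph band of `PlanarGraphBandKinematics.lean`
with a profile independent of `x`: centre line `y = y(t)` (the whole run translates vertically
in an `H`-phase), material map `x ↦ Ξ(t, x)` with `Ξₓ > 0` (piecewise-affine in the designs: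
rigid on the junction zones, stretching on the flex piece in between; here ARBITRARY smooth), and
transverse reference profile `Gr`:

* `runScalar Gr y Ξx t z = Gr ((z₁ - y(t)) / Ξₓ(t, z₀))` — band half-width `∝ Ξₓ`, i.e. the
  local amount of material;
* `runVelocity y' Ξx Ξt Ξxx Ξxt t z = (g, y' - (z₁ - y) gₓ)` with the Eulerian rate `g = -Ξₜ/Ξₓ`;
* `runStream y y' Ξx Ξt c t z = g (z₁ - y) - y' z₀ + c(t)` — with the free additive function
  `c(t)` by which consecutive elements of a chain are matched.

Proved: transport (`transport_runScalar`), `runVelocity = ∇⊥ runStream`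
(`runVelocity_eq_perpGrad_runStream`), joint smoothness, the **band lemma** (`runScalar ≠ 0`
forces `|z₁ - y(t)| < r Λ` when `Gr` vanishes off `(-r, r)` and `Ξₓ ≤ Λ`;
`abs_sub_lt_of_runScalar_ne_zero`), the bound `|runScalar| ≤ M` from `|Gr| ≤ M`, rigidity
(`runVelocity` is the translation `(0, y')` where `Ξₜ = Ξₓₜ = 0`), and `perpGrad_add_const`.
Vertical runs are the conjugates by the swap frame (`PlanarLinearFrame.lean`).

Folklore; no named facts. Infrastructure towards a discharge of `acm_compatible_blocks`
(`QuasiSelfSimilarCompatibleBlocks.lean`).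

## References

* G. Alberti, G. Crippa, A. L. Mazzucato, *Exponential self-similar mixing by incompressible
  flows*, J. Amer. Math. Soc. 32 (2019), 445–490, §7 (arXiv:1605.02090).
-/

noncomputable section

open Function Set Filter
open scoped Topology ContDiff

namespace Literature.Analysis.FluidPDE

namespace PlanarKinematics

/-- The plane `ℝ²` as a Euclidean space. [folklore] -/
local notation "E²" => EuclideanSpace ℝ (Fin 2)

variable {G : Type*} [NormedAddCommGroup G] [NormedSpace ℝ G]

/-! ## Definitions -/

/-- **Run element, scalar**: `Θ(t, z) = Gr ((z₁ - y(t)) / Ξₓ(t, z₀))`. [folklore] -/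
def runScalar (Gr : ℝ → G) (y : ℝ → ℝ) (Ξx : ℝ → ℝ → ℝ) (t : ℝ) (z : E²) : G :=
  Gr ((z 1 - y t) / Ξx t (z 0))

/-- **Run element, velocity**: the graph-band velocity with constant-in-`x` profile `T = y(t)`:
`V = (g, y' - (z₁ - y) gₓ)`, `g = -Ξₜ/Ξₓ`. [folklore] -/
def runVelocity (y y' : ℝ → ℝ) (Ξx Ξt Ξxx Ξxt : ℝ → ℝ → ℝ) (t : ℝ) (z : E²) : E² :=
  graphVelocity (axialRate Ξx Ξt) (axialRateDeriv Ξx Ξt Ξxx Ξxt) (fun s _ => y s) (fun s _ => y' s)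
    (fun _ _ => 0) t z

/-- **Run element, stream function**: `H = g (z₁ - y) - y' z₀ + c(t)`. [folklore] -/
def runStream (y y' : ℝ → ℝ) (Ξx Ξt : ℝ → ℝ → ℝ) (c : ℝ → ℝ) (t : ℝ) (z : E²) : ℝ :=
  graphStream (axialRate Ξx Ξt) (fun s _ => y s) (fun s u => y' s * u) t z + c t

omit [NormedAddCommGroup G] [NormedSpace ℝ G] in
/-- Unfolding the run scalar. [folklore] -/
theorem runScalar_apply (Gr : ℝ → G) (y : ℝ → ℝ) (Ξx : ℝ → ℝ → ℝ) (t : ℝ) (z : E²) :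
    runScalar Gr y Ξx t z = Gr ((z 1 - y t) / Ξx t (z 0)) := rfl

omit [NormedAddCommGroup G] [NormedSpace ℝ G] in
/-- The run scalar is the profile `w ↦ Gr w₁` carried by the graph-band pullback with `T = y(t)`
(any `Ξ`). [folklore] -/
theorem runScalar_eq_comp_graphPullback (Gr : ℝ → G) (y : ℝ → ℝ) (Ξ Ξx : ℝ → ℝ → ℝ) (t : ℝ) (z : E²) :
    runScalar Gr y Ξx t z = (fun w : E² => Gr (w 1)) (graphPullback (fun s _ => y s) Ξ Ξx t z) := by
  simp only [runScalar, graphPullback_apply, vec2_apply_one]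

/-- Unfolding the run velocity. [folklore] -/
theorem runVelocity_apply (y y' : ℝ → ℝ) (Ξx Ξt Ξxx Ξxt : ℝ → ℝ → ℝ) (t : ℝ) (z : E²) :
    runVelocity y y' Ξx Ξt Ξxx Ξxt t z = vec2 (axialRate Ξx Ξt t (z 0))
      (y' t - (z 1 - y t) * axialRateDeriv Ξx Ξt Ξxx Ξxt t (z 0)) := by
  rw [runVelocity, graphVelocity_apply, vec2_eq_vec2_iff]
  exact ⟨rfl, by ring⟩

/-- Unfolding the run stream function. [folklore] -/
theorem runStream_apply (y y' : ℝ → ℝ) (Ξx Ξt : ℝ → ℝ → ℝ) (c : ℝ → ℝ) (t : ℝ) (z : E²) :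
    runStream y y' Ξx Ξt c t z = axialRate Ξx Ξt t (z 0) * (z 1 - y t) - y' t * z 0 + c t := by
  rw [runStream, graphStream_apply]

/-! ## Transport and stream function -/

/-- **The run element is transported** by its velocity, at every point where the data are
differentiable and `Ξₓ ≠ 0`. [folklore] -/
theorem transport_runScalar {Gr : ℝ → G} {y : ℝ → ℝ} {y't : ℝ} {Ξ Ξx Ξt Ξxx Ξxt : ℝ → ℝ → ℝ} {t : ℝ}
    {z : E²} (hG : DifferentiableAt ℝ Gr ((z 1 - y t) / Ξx t (z 0))) (hy : HasDerivAt y y't t)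
    (ht : HasDerivAt (fun s => Ξ s (z 0)) (Ξt t (z 0)) t) (hx : HasDerivAt (Ξ t) (Ξx t (z 0)) (z 0))
    (hxx : HasDerivAt (Ξx t) (Ξxx t (z 0)) (z 0)) (hxt : HasDerivAt (fun s => Ξx s (z 0)) (Ξxt t (z 0)) t)
    (hne : Ξx t (z 0) ≠ 0) (y' : ℝ → ℝ) (hy' : y' t = y't) :
    deriv (fun s => runScalar Gr y Ξx s z) t +
      fderiv ℝ (runScalar Gr y Ξx t) z (runVelocity y y' Ξx Ξt Ξxx Ξxt t z) = 0 := by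
  have hproj : DifferentiableAt ℝ (fun w : E² => Gr (w 1)) (graphPullback (fun s _ => y s) Ξ Ξx t z) := by
    have h1 : DifferentiableAt ℝ (fun w : E² => w 1) (graphPullback (fun s _ => y s) Ξ Ξx t z) :=
      (EuclideanSpace.proj (1 : Fin 2) : E² →L[ℝ] ℝ).differentiableAt
    refine DifferentiableAt.comp (graphPullback (fun s _ => y s) Ξ Ξx t z) ?_ h1
    simpa only [graphPullback_apply, vec2_apply_one] using hG
  have hT : HasDerivAt (fun s => (fun s (_ : ℝ) => y s) s (z 0)) ((fun s (_ : ℝ) => y' s) t (z 0)) t := by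
    simpa only [hy'] using hy
  have hTx : HasDerivAt ((fun s (_ : ℝ) => y s) t) ((fun (_ : ℝ) (_ : ℝ) => (0 : ℝ)) t (z 0)) (z 0) :=
    hasDerivAt_const _ _
  have h := transport_comp_graphPullback (Θ := fun w : E² => Gr (w 1)) (T := fun s _ => y s)
    (Tt := fun s _ => y' s) (Tx := fun _ _ => (0 : ℝ)) hproj hT hTx ht hx hxx hxt hne
  have e1 : (fun s => (fun w : E² => Gr (w 1)) (graphPullback (fun s _ => y s) Ξ Ξx s z)) =
      fun s => runScalar Gr y Ξx s z := by
    funext s; exact (runScalar_eq_comp_graphPullback Gr y Ξ Ξx s z).symm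
  have e2 : (fun w => (fun w : E² => Gr (w 1)) (graphPullback (fun s _ => y s) Ξ Ξx t w)) = runScalar Gr y Ξx t := by
    funext w; exact (runScalar_eq_comp_graphPullback Gr y Ξ Ξx t w).symm
  rw [e1, e2] at h
  exact h

/-- Adding a constant to a stream function does not change its perpendicular gradient. [folklore] -/
theorem perpGrad_add_const (H : E² → ℝ) (c : ℝ) (z : E²) : perpGrad (fun w => H w + c) z = perpGrad H z := by
  simp only [perpGrad_apply, fderiv_add_const]

/-- **The run velocity is the perpendicular gradient of the run stream function.** [folklore] -/
theorem runVelocity_eq_perpGrad_runStream {y y' : ℝ → ℝ} {Ξx Ξt Ξxx Ξxt : ℝ → ℝ → ℝ} {c : ℝ → ℝ} {t : ℝ}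
    {z : E²} (hg : HasDerivAt (axialRate Ξx Ξt t) (axialRateDeriv Ξx Ξt Ξxx Ξxt t (z 0)) (z 0)) :
    runVelocity y y' Ξx Ξt Ξxx Ξxt t z = perpGrad (runStream y y' Ξx Ξt c t) z := by
  have hT : HasDerivAt ((fun s (_ : ℝ) => y s) t) ((fun (_ : ℝ) (_ : ℝ) => (0 : ℝ)) t (z 0)) (z 0) :=
    hasDerivAt_const _ _
  have hP : HasDerivAt ((fun s u => y' s * u) t) ((fun s (_ : ℝ) => y' s) t (z 0)) (z 0) := by
    simpa using (hasDerivAt_id (z 0)).const_mul (y' t)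
  have h := graphVelocity_eq_perp_fderiv_graphStream (g := axialRate Ξx Ξt)
    (gx := axialRateDeriv Ξx Ξt Ξxx Ξxt) (T := fun s _ => y s) (Tt := fun s _ => y' s) (Tx := fun _ _ => (0 : ℝ))
    (P := fun s u => y' s * u) hg hT hP
  have e : runStream y y' Ξx Ξt c t =
      fun w => graphStream (axialRate Ξx Ξt) (fun s _ => y s) (fun s u => y' s * u) t w + c t := rfl
  rw [runVelocity, h, e, perpGrad_add_const, perpGrad_apply]

/-! ## Smoothness -/

/-- **The run scalar is smooth** when `Gr`, `y`, `Ξₓ` are and `Ξₓ` does not vanish. [folklore] -/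
theorem contDiff_uncurry_runScalar {Gr : ℝ → G} {y : ℝ → ℝ} {Ξx : ℝ → ℝ → ℝ} (hGr : ContDiff ℝ ∞ Gr)
    (hy : ContDiff ℝ ∞ y) (hΞx : ContDiff ℝ ∞ (uncurry Ξx)) (hne : ∀ t x, Ξx t x ≠ 0) :
    ContDiff ℝ ∞ (uncurry (runScalar Gr y Ξx)) := by
  have h0 : ContDiff ℝ ∞ fun p : ℝ × E² => p.2 0 := (contDiff_coord 0).comp contDiff_snd
  have h1 : ContDiff ℝ ∞ fun p : ℝ × E² => p.2 1 := (contDiff_coord 1).comp contDiff_snd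
  have hΞ : ContDiff ℝ ∞ fun p : ℝ × E² => Ξx p.1 (p.2 0) := hΞx.comp (contDiff_fst.prodMk h0)
  have e : uncurry (runScalar Gr y Ξx) = fun p : ℝ × E² => Gr ((p.2 1 - y p.1) / Ξx p.1 (p.2 0)) := by
    funext p; rfl
  rw [e]
  exact hGr.comp ((h1.sub (hy.comp contDiff_fst)).div hΞ fun p => hne p.1 (p.2 0))

/-- **The run velocity is smooth.** [folklore] -/
theorem contDiff_uncurry_runVelocity {y y' : ℝ → ℝ} {Ξx Ξt Ξxx Ξxt : ℝ → ℝ → ℝ} (hy : ContDiff ℝ ∞ y)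
    (hy' : ContDiff ℝ ∞ y') (hΞx : ContDiff ℝ ∞ (uncurry Ξx)) (hΞt : ContDiff ℝ ∞ (uncurry Ξt))
    (hΞxx : ContDiff ℝ ∞ (uncurry Ξxx)) (hΞxt : ContDiff ℝ ∞ (uncurry Ξxt)) (hne : ∀ t x, Ξx t x ≠ 0) :
    ContDiff ℝ ∞ (uncurry (runVelocity y y' Ξx Ξt Ξxx Ξxt)) :=
  contDiff_uncurry_graphVelocity (T := fun s _ => y s) (Tt := fun s _ => y' s) (Tx := fun _ _ => (0 : ℝ))
    (contDiff_uncurry_axialRate hΞx hΞt hne) (contDiff_uncurry_axialRateDeriv hΞx hΞt hΞxx hΞxt hne)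
    (hy.comp contDiff_fst) (hy'.comp contDiff_fst) contDiff_const

/-- **The run stream function is smooth.** [folklore] -/
theorem contDiff_uncurry_runStream {y y' : ℝ → ℝ} {Ξx Ξt : ℝ → ℝ → ℝ} {c : ℝ → ℝ} (hy : ContDiff ℝ ∞ y)
    (hy' : ContDiff ℝ ∞ y') (hΞx : ContDiff ℝ ∞ (uncurry Ξx)) (hΞt : ContDiff ℝ ∞ (uncurry Ξt))
    (hc : ContDiff ℝ ∞ c) (hne : ∀ t x, Ξx t x ≠ 0) : ContDiff ℝ ∞ (uncurry (runStream y y' Ξx Ξt c)) := by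
  have hT : ContDiff ℝ ∞ (uncurry fun s (_ : ℝ) => y s) := hy.comp contDiff_fst
  have hP : ContDiff ℝ ∞ (uncurry fun s u => y' s * u) := (hy'.comp contDiff_fst).mul contDiff_snd
  have h := contDiff_uncurry_graphStream (T := fun s _ => y s) (P := fun s u => y' s * u)
    (contDiff_uncurry_axialRate hΞx hΞt hne) hT hP
  have e : uncurry (runStream y y' Ξx Ξt c) = fun p : ℝ × E² =>
      uncurry (graphStream (axialRate Ξx Ξt) (fun s _ => y s) (fun s u => y' s * u)) p + c p.1 := by
    funext p; rfl
  rw [e]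
  exact h.add (hc.comp contDiff_fst)

/-! ## The band, the bound, rigidity -/

omit [NormedSpace ℝ G] in
/-- **Band lemma**: if the profile vanishes off `(-r, r)` and `0 < Ξₓ(t, z₀) ≤ Λ`, a point where the
run scalar does not vanish lies in the band `|z₁ - y(t)| < r Λ`. [folklore] -/
theorem abs_sub_lt_of_runScalar_ne_zero {Gr : ℝ → G} {y : ℝ → ℝ} {Ξx : ℝ → ℝ → ℝ} {r Λ : ℝ} {t : ℝ} {z : E²}
    (hGr : ∀ q, Gr q ≠ 0 → |q| < r) (hpos : 0 < Ξx t (z 0)) (hΛ : Ξx t (z 0) ≤ Λ)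
    (hne : runScalar Gr y Ξx t z ≠ 0) : |z 1 - y t| < r * Λ := by
  have hq := hGr _ hne
  rw [abs_div, abs_of_pos hpos, div_lt_iff₀ hpos] at hq
  have hr : 0 ≤ r := by
    have := (abs_nonneg _).trans_lt (hGr _ hne)
    exact this.le
  calc |z 1 - y t| < r * Ξx t (z 0) := hq
    _ ≤ r * Λ := mul_le_mul_of_nonneg_left hΛ hr

omit [NormedSpace ℝ G] in
/-- **Bound**: `‖runScalar‖ ≤ M` when `‖Gr‖ ≤ M`. [folklore] -/
theorem norm_runScalar_le {Gr : ℝ → G} {y : ℝ → ℝ} {Ξx : ℝ → ℝ → ℝ} {M : ℝ} (hM : ∀ q, ‖Gr q‖ ≤ M)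
    (t : ℝ) (z : E²) : ‖runScalar Gr y Ξx t z‖ ≤ M := hM _

/-- **Bound, real profile**: `|runScalar| ≤ M` when `|Gr| ≤ M`. [folklore] -/
theorem abs_runScalar_le {Gr : ℝ → ℝ} {y : ℝ → ℝ} {Ξx : ℝ → ℝ → ℝ} {M : ℝ} (hM : ∀ q, |Gr q| ≤ M)
    (t : ℝ) (z : E²) : |runScalar Gr y Ξx t z| ≤ M := hM _

/-- **Rigidity**: where `Ξₜ(t, z₀) = 0` and `Ξₓₜ(t, z₀) = 0` (the material of the run is at rest
relative to the translation), the run velocity is the translation `(0, y'(t))`. [folklore] -/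
theorem runVelocity_of_rigid {y y' : ℝ → ℝ} {Ξx Ξt Ξxx Ξxt : ℝ → ℝ → ℝ} {t : ℝ} {z : E²}
    (ht : Ξt t (z 0) = 0) (hxt : Ξxt t (z 0) = 0) : runVelocity y y' Ξx Ξt Ξxx Ξxt t z = vec2 0 (y' t) := by
  rw [runVelocity_apply, vec2_eq_vec2_iff, axialRate, axialRateDeriv, ht, hxt]
  constructor <;> ring

/-- **Rigid stream function**: where `Ξₜ(t, z₀) = 0`, `runStream = -y' z₀ + c`. [folklore] -/
theorem runStream_of_rigid {y y' : ℝ → ℝ} {Ξx Ξt : ℝ → ℝ → ℝ} {c : ℝ → ℝ} {t : ℝ} {z : E²}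
    (ht : Ξt t (z 0) = 0) : runStream y y' Ξx Ξt c t z = -(y' t * z 0) + c t := by
  rw [runStream_apply, axialRate, ht]; ring

/-- **Static run**: with `y' = 0`, `Ξₜ = 0`, `Ξₓₜ = 0` at the point, the run velocity vanishes.
[folklore] -/
theorem runVelocity_eq_zero_of_static {y y' : ℝ → ℝ} {Ξx Ξt Ξxx Ξxt : ℝ → ℝ → ℝ} {t : ℝ} {z : E²}
    (hy : y' t = 0) (ht : Ξt t (z 0) = 0) (hxt : Ξxt t (z 0) = 0) :
    runVelocity y y' Ξx Ξt Ξxx Ξxt t z = 0 := by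
  rw [runVelocity_of_rigid ht hxt, hy]
  simp [vec2_eq_zero_iff]

end PlanarKinematics

end Literature.Analysis.FluidPDE
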